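import Literature.LinearAlgebra.Subspace.MoebiusCount
import HarnessLib

/-!
# The product formula `Σ_Y q^{C(codim Y + 1, 2)} = ∏_{i=1}^{m} (1 + q^i)` for the subspaces of a
# finite vector space (the `q`-binomial theorem at `z = q`)

Topic `LinearAlgebra/Subspace`; a companion of `MoebiusCount.lean`, proved from its recursion
`card_ge_codim_eq_add` (Mathlib otherwise). There is no definition and no named fact.

Let `W` be a finite-dimensional vector space over a finite field `k` with `q = Nat.card k` elements
and `C ≤ W` a subspace of codimension `m`. Writing `A(C, j) = #{Y : C ≤ Y ≤ W, codim Y = j}` (the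
Gaussian binomial coefficient `[m choose j]_q`, as in `MoebiusCount.lean`), the main result is

`∑_{j} q^{j(j+1)/2} A(C, j) = ∏_{i=1}^{m} (1 + q^i)`

(`sum_pow_choose_succ_mul_card_ge_codim`; the case `C = ⊥` is
`sum_pow_choose_succ_mul_card_codim`). This is the evaluation at `z = q` of the `q`-binomial
theorem `∑_j [m choose j]_q q^{j(j-1)/2} z^j = ∏_{i=0}^{m-1} (1 + z q^i)` (Gauss; Andrews, *The
theory of partitions*, Thm. 3.3, eq. (3.3.6)), and it is the lattice-of-subspaces count behind the
number `2ⁿ ∏_{i=1}^{n} (2^i + 1)` of `n`-qubit stabilizer states (Aaronson–Gottesman 2004,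
Prop. 2; Gross 2006), which is its consumer in `Literature/Computability/QuantumComplexity/`.

## Proof

As for Shimura's alternating sum in `MoebiusCount.lean`, no closed form of the Gaussian binomials
is used: for `e ∉ C` the recursion `A(C, j) = A(C + ke, j) + q^{m - j} A(C + ke, j - 1)`
(`card_ge_codim_eq_add`) and `q^{C(j+1,2)} q^{m-j} = q^m q^{C(j,2)}` give
`S(C) = (1 + q^m) S(C + ke)`, whence the product by induction on the codimension `m`.

## References

* G. E. Andrews, *The theory of partitions*, Encyclopedia Math. Appl. 2, Addison-Wesley 1976,
  Thm. 3.3, eq. (3.3.6) (the `q`-binomial theorem) and §3.3 (Gaussian polynomials count subspaces).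
* S. Aaronson, D. Gottesman, *Improved simulation of stabilizer circuits*, Phys. Rev. A 70 (2004)
  052328, Prop. 2 (the consumer). [AaronsonGottesman2004]
-/

open Module Submodule Finset

namespace Literature.LinearAlgebra.Subspace

variable {k W : Type*} [Field k] [Finite k] [AddCommGroup W] [Module k W] [FiniteDimensional k W]

/-- **`Σ_{Y ⊇ C} q^{C(codim Y + 1, 2)} = ∏_{i=1}^{codim C} (1 + q^i)`** (the `q`-binomial theorem
`∑_j [m choose j]_q q^{j(j-1)/2} z^j = ∏_{i<m} (1 + z q^i)` at `z = q`, with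
`[m choose j]_q = #{Y ⊇ C : codim Y = j}`, `m = codim C`). Over a field with `q = Nat.card k`
elements, for every subspace `C` of a finite-dimensional space `W`:
`∑_j q^{C(j+1,2)} #{Y ⊇ C : codim Y = j} = ∏_{i < dim W - dim C} (1 + q^{i+1})`. Proof by induction
on the codimension through `card_ge_codim_eq_add`: `S(C) = (1 + q^m) S(C + ke)` for `e ∉ C`.
[folklore] -/
theorem sum_pow_choose_succ_mul_card_ge_codim (C : Submodule k W) :
    ∑ j ∈ Finset.range (finrank k W + 1), Nat.card k ^ ((j + 1).choose 2) *
        Nat.card {Y : Submodule k W // C ≤ Y ∧ finrank k Y + j = finrank k W} =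
      ∏ i ∈ Finset.range (finrank k W - finrank k C), (1 + Nat.card k ^ (i + 1)) := by
  -- strong induction on the codimension of `C`
  suffices h : ∀ (d : ℕ) (C : Submodule k W), finrank k W - finrank k C = d →
      ∑ j ∈ Finset.range (finrank k W + 1), Nat.card k ^ ((j + 1).choose 2) *
        Nat.card {Y : Submodule k W // C ≤ Y ∧ finrank k Y + j = finrank k W} =
      ∏ i ∈ Finset.range (finrank k W - finrank k C), (1 + Nat.card k ^ (i + 1)) from h _ C rfl
  intro d
  induction d using Nat.strong_induction_on with
  | _ d ih =>
  intro C hd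
  set n := finrank k W with hn
  set q : ℕ := Nat.card k with hq
  by_cases hC : C = ⊤
  · -- only `j = 0` contributes, with the single subspace `Y = ⊤`; the product is empty
    subst hC
    rw [finrank_top, Nat.sub_self, Finset.prod_range_zero, Finset.sum_range_succ', card_ge_codim_zero]
    rw [Finset.sum_eq_zero fun j _ => ?_]
    · simp
    · rw [card_ge_codim_eq_zero ⊤ (by rw [finrank_top]; omega), mul_zero]
  -- a vector outside `C`
  obtain ⟨e, he⟩ : ∃ e : W, e ∉ C := by
    by_contra! h
    exact hC (eq_top_iff.mpr fun x _ => h x)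
  set C' := C ⊔ (k ∙ e) with hC'
  have hdimC' : finrank k C' = finrank k C + 1 := finrank_sup_span_singleton he
  have hCn : finrank k C + 1 ≤ n := by
    rw [← hdimC', hn, ← finrank_top (R := k) (M := W)]
    exact Submodule.finrank_mono le_top
  -- the induction hypothesis for `C'`
  have ih' := ih (n - finrank k C') (by omega) C' rfl
  -- abbreviations for the graded counts
  set A : ℕ → ℕ := fun j => Nat.card {Y : Submodule k W // C ≤ Y ∧ finrank k Y + j = n} with hA
  set A' : ℕ → ℕ := fun j => Nat.card {Y : Submodule k W // C' ≤ Y ∧ finrank k Y + j = n} with hA'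
  -- the recursion, termwise, for `j + 1`
  have hrec : ∀ j, A (j + 1) = A' (j + 1) + q ^ (n - finrank k C - (j + 1)) * A' j := by
    intro j
    simp only [hA, hA', hq]
    rw [card_ge_codim_eq_add C he (Nat.le_add_left 1 j), Nat.add_sub_cancel]
  -- vanishing of `A' j` beyond the maximal codimension `n - dim C - 1`
  have hA'0 : ∀ j, n - finrank k C - 1 < j → A' j = 0 := by
    intro j hj
    simp only [hA']
    exact card_ge_codim_eq_zero C' (by omega)
  have hA'n : A' n = 0 := hA'0 n (by omega)
  have h0 : A 0 = 1 := by simp only [hA]; exact card_ge_codim_zero C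
  have h0' : A' 0 = 1 := by simp only [hA']; exact card_ge_codim_zero C'
  -- the codimension `m ≥ 1` of `C`
  obtain ⟨m', hm'⟩ : ∃ m', n - finrank k C = m' + 1 := ⟨n - finrank k C - 1, by omega⟩
  have hcod' : n - finrank k C' = m' := by omega
  -- `S(C) = (1 + q^m) S(C')`
  have hS' : ∑ j ∈ Finset.range (n + 1), q ^ ((j + 1).choose 2) * A' j =
      ∑ j ∈ Finset.range n, q ^ ((j + 1).choose 2) * A' j := by
    rw [Finset.sum_range_succ, hA'n, mul_zero, add_zero]
  have key : ∑ j ∈ Finset.range (n + 1), q ^ ((j + 1).choose 2) * A j =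
      (1 + q ^ (m' + 1)) * ∑ j ∈ Finset.range (n + 1), q ^ ((j + 1).choose 2) * A' j := by
    rw [Finset.sum_range_succ' _ n, Finset.sum_range_succ' (fun j => q ^ ((j + 1).choose 2) * A' j) n]
    simp only [h0, h0', zero_add, show Nat.choose 1 2 = 0 from rfl, pow_zero, mul_one]
    have hterm : ∀ j ∈ Finset.range n, q ^ ((j + 1 + 1).choose 2) * A (j + 1) =
        q ^ ((j + 1 + 1).choose 2) * A' (j + 1) +
          q ^ (m' + 1) * (q ^ ((j + 1).choose 2) * A' j) := by
      intro j _
      rw [hrec j, mul_add]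
      by_cases hj : j ≤ m'
      · have e1 : (j + 1 + 1).choose 2 = (j + 1).choose 2 + (j + 1) := by
          rw [Nat.choose_succ_left _ _ (by norm_num : 0 < 2), Nat.choose_one_right]; ring
        have hpow : q ^ ((j + 1 + 1).choose 2) * q ^ (n - finrank k C - (j + 1)) =
            q ^ (m' + 1) * q ^ ((j + 1).choose 2) := by
          rw [e1, ← pow_add, ← pow_add]
          congr 1
          omega
        rw [← mul_assoc, hpow, mul_assoc]
      · rw [hA'0 j (by omega), mul_zero, mul_zero, mul_zero, mul_zero]
    rw [Finset.sum_congr rfl hterm, Finset.sum_add_distrib, ← Finset.mul_sum, ← hS',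
      Finset.sum_range_succ' (fun j => q ^ ((j + 1).choose 2) * A' j) n]
    simp only [h0', show Nat.choose 1 2 = 0 from rfl, pow_zero, mul_one]
    ring
  rw [key, ih', hcod', hm', Finset.prod_range_succ]
  ring

/-- **The count over all subspaces**: `∑_j q^{C(j+1,2)} #{Y ≤ W : codim Y = j} = ∏_{i=1}^{dim W} (1 + q^i)`
(the `q`-binomial theorem at `z = q`; `#{Y : codim Y = j} = [dim W choose j]_q`). [folklore] -/
theorem sum_pow_choose_succ_mul_card_codim :
    ∑ j ∈ Finset.range (finrank k W + 1), Nat.card k ^ ((j + 1).choose 2) *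
        Nat.card {Y : Submodule k W // finrank k Y + j = finrank k W} =
      ∏ i ∈ Finset.range (finrank k W), (1 + Nat.card k ^ (i + 1)) := by
  have h := sum_pow_choose_succ_mul_card_ge_codim (⊥ : Submodule k W)
  rw [finrank_bot, Nat.sub_zero] at h
  rw [← h]
  refine Finset.sum_congr rfl fun j _ => ?_
  congr 1
  exact Nat.card_congr (Equiv.subtypeEquivRight fun Y => by simp)

end Literature.LinearAlgebra.Subspace
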